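import Mathlib.NumberTheory.NumberField.ProductFormula
import Mathlib.Analysis.SpecialFunctions.Log.Basic
import Mathlib.Algebra.BigOperators.Finsupp.Basic
import Mathlib.Algebra.Group.Pi.Lemmas
import HarnessLib

/-!
# Frobenioids I, Example 6.3: effective arithmetic divisors on a number field

Mochizuki, *The geometry of Frobenioids I: the general theory*, Kyushu J. Math. **62** (2008)
293–400, §6 "Some Motivating Examples", Example 6.3 "A Frobenioid of Arithmetic Origin", kurims
text pp. 112–114 [cite: MochizukiFrdI2008, Ex. 6.3 pp.112-114]. This file types the *concrete
number-theoretic data* of the example over Mathlib's number fields and places, and proves the one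
claim printed about that data ("one verifies immediately that `deg^arith_L` vanishes on the image
of `B(L)`", p. 114) from Mathlib's product formula:

* `V(F)`, the set of valuations of `F` with complex conjugate archimedean valuations identified
  (p. 112) = `InfinitePlace F ⊕ FinitePlace F` (`Places`);
* `ord(F_v) = F_v^×/O_v^×`, `ord(O_v^▷) = O_v^▷/O_v^×` (p. 112): "`≅ ℤ`, `≅ ℤ_{≥0}` if `v` is
  nonarchimedean; `≅ ℝ`, `≅ ℝ_{≥0}` if `v` is archimedean" (p. 113). **Dictionary:** we render
  these quotient monoids *by those isomorphisms*, i.e. as `ℤ`/`ℕ` via `ord_v` at a finite place and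
  as `ℝ`/`ℝ_{≥0}` via `x ↦ -log |x|_v` at an infinite place (`|·|_v` = Mathlib's normalised absolute
  value `w x` of the place); they are written *additively* here (divisor notation) — the paper's
  general monoid conventions are additive too; the tree's multiplicative `CommMonoid` rendering of
  abstract Frobenioid monoids (`Monoids.lean`) is recovered by `Multiplicative (EffArithDivisor F)`;
* `Φ(F) = ⊕_{v ∈ V(F)} ord(O_v^▷)`, the monoid of *effective arithmetic divisors* (p. 113) =
  `EffArithDivisor F`; `Φ(F)^gp = ⊕_v ord(F_v)`, the group of *arithmetic divisors* = `ArithDivisor F`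
  with the inclusion `EffArithDivisor.toArithDivisor` (injective, and every arithmetic divisor is a
  difference of two effective ones: `ArithDivisor.exists_sub_eq`, which is what makes `ArithDivisor F`
  the groupification);
* the natural homomorphism `B(F) := F^× → Φ(F)^gp` (p. 113) = `principalArithDivisorHom`
  (`f ↦ (ord_v f)_v`, "all but a finite number of which are zero" = `Finsupp` on the finite part);
* the *arithmetic degree* `deg^arith_F : Φ(F)^gp → ℝ` (pp. 113–114) = `arithDegree`: on the factor of
  a nonarchimedean `v` the class of `λ ∈ O_v^▷` goes to `log #(O_v/(λ)) = ord_v(λ) · log N(v)`; on the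
  factor of an archimedean `v` the class of `λ ∈ ℝ_{>0} ⊆ F_v` goes to `-[F_v : ℝ] · log λ`, i.e. the
  additive coordinate `t = -log|x|_v` goes to `[F_v : ℝ] · t` (`InfinitePlace.mult`);
* **claim (p. 114), proved:** `arithDegree_principalArithDivisor : deg^arith (div f) = 0`.

Deliberately NOT here (they need the Frobenioid vocabulary of Definitions 1.1–1.3 / Theorem 5.2 and
are typed in the §6 statement file): the model Frobenioid `C_{F̃/F}` itself, "`O^×(A) = O^▷(A) = μ(L)`",
"`Φ(L)` is perf-factorial", "`Prime(Φ(L)) ≃ V(L)`", functoriality in `F`. No statement of the paper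
is strengthened; nothing here is specific to the abc programme.
-/

noncomputable section

namespace Literature.AlgebraicGeometry.Frobenioids

open NumberField IsDedekindDomain

variable (F : Type*) [Field F] [NumberField F]

/-! ### Places and the divisor monoids (pp. 112–113) -/

/-- `V(F)`: the valuations of the number field `F`, complex archimedean valuations being identified
with their complex conjugates (FrdI Ex. 6.3 p. 112) — Mathlib's infinite places together with its
finite places. [cite: MochizukiFrdI2008, Ex. 6.3 p.112] -/
abbrev Places : Type _ := InfinitePlace F ⊕ FinitePlace F

/-- `Φ(F) = ⊕_{v ∈ V(F)} ord(O_v^▷)`, the monoid of *effective arithmetic divisors* on `F`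
(FrdI Ex. 6.3 p. 113): a finitely supported `ℤ_{≥0}`-valued function on the finite places together
with an `ℝ_{≥0}`-valued function on the (finitely many) infinite places.
[cite: MochizukiFrdI2008, Ex. 6.3 p.113] -/
abbrev EffArithDivisor : Type _ := (FinitePlace F →₀ ℕ) × (InfinitePlace F → NNReal)

/-- `Φ(F)^gp = ⊕_{v ∈ V(F)} ord(F_v)`, the group of *arithmetic divisors* on `F` (FrdI Ex. 6.3
p. 113). [cite: MochizukiFrdI2008, Ex. 6.3 p.113] -/
abbrev ArithDivisor : Type _ := (FinitePlace F →₀ ℤ) × (InfinitePlace F → ℝ)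

namespace EffArithDivisor

/-- The inclusion `Φ(F) ⊆ Φ(F)^gp` of effective arithmetic divisors into arithmetic divisors
(`ord(O_v^▷) ⊆ ord(F_v)`, FrdI Ex. 6.3 pp. 112–113). [cite: MochizukiFrdI2008, Ex. 6.3 p.113] -/
def toArithDivisor : EffArithDivisor F →+ ArithDivisor F :=
  AddMonoidHom.prodMap (Finsupp.mapRange.addMonoidHom (Nat.castAddMonoidHom ℤ))
    (AddMonoidHom.compLeft NNReal.toRealHom.toAddMonoidHom (InfinitePlace F))

/-- Components of the inclusion `Φ(F) → Φ(F)^gp`: finite part. [cite: MochizukiFrdI2008, Ex. 6.3 p.113] -/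
@[simp] theorem toArithDivisor_fst (D : EffArithDivisor F) (w : FinitePlace F) :
    (toArithDivisor F D).1 w = (D.1 w : ℤ) := by
  simp [toArithDivisor]

/-- Components of the inclusion `Φ(F) → Φ(F)^gp`: infinite part. [cite: MochizukiFrdI2008, Ex. 6.3 p.113] -/
@[simp] theorem toArithDivisor_snd (D : EffArithDivisor F) (w : InfinitePlace F) :
    (toArithDivisor F D).2 w = (D.2 w : ℝ) := by
  simp [toArithDivisor]

/-- `Φ(F) → Φ(F)^gp` is injective (`Φ(F)` is integral). [cite: MochizukiFrdI2008, Ex. 6.3 p.113] -/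
theorem toArithDivisor_injective : Function.Injective (toArithDivisor F) := by
  intro D E h
  refine Prod.ext (Finsupp.ext fun w => ?_) (funext fun w => ?_)
  · have := congrArg (fun d : ArithDivisor F => d.1 w) h
    simpa using this
  · have := congrArg (fun d : ArithDivisor F => d.2 w) h
    simpa using this

end EffArithDivisor

/-- Every arithmetic divisor is a difference of two effective ones; together with the injectivity of
`Φ(F) → Φ(F)^gp` this exhibits `⊕_v ord(F_v)` as the groupification `Φ(F)^gp` (FrdI Ex. 6.3 p. 113,
"`Φ(F)^gp = ⊕_{v ∈ V(F)} ord(F_v)`"). [cite: MochizukiFrdI2008, Ex. 6.3 p.113] -/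
theorem ArithDivisor.exists_sub_eq (d : ArithDivisor F) :
    ∃ D E : EffArithDivisor F,
      EffArithDivisor.toArithDivisor F D - EffArithDivisor.toArithDivisor F E = d := by
  classical
  refine ⟨(d.1.mapRange Int.toNat (by simp), fun w => Real.toNNReal (d.2 w)),
    (d.1.mapRange (fun n => Int.toNat (-n)) (by simp), fun w => Real.toNNReal (-d.2 w)), ?_⟩
  refine Prod.ext (Finsupp.ext fun w => ?_) (funext fun w => ?_)
  · simp only [Prod.fst_sub, Finsupp.coe_sub, Pi.sub_apply, EffArithDivisor.toArithDivisor_fst,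
      Finsupp.mapRange_apply]
    omega
  · simp only [Prod.snd_sub, Pi.sub_apply, EffArithDivisor.toArithDivisor_snd, Real.coe_toNNReal']
    rcases le_total 0 (d.2 w) with h | h
    · rw [max_eq_left h, max_eq_right (by linarith), sub_zero]
    · rw [max_eq_right h, max_eq_left (by linarith), zero_sub, neg_neg]

/-! ### `ord_v` at a finite place and the principal divisor map `B(F) = F^× → Φ(F)^gp` (p. 113) -/

section Ord

variable {F}

/-- The `v`-adic valuation of a unit of `F` is a nonzero element of `ℤᵐ⁰`. [folklore] -/
private theorem valuation_coe_units_ne_zero (w : FinitePlace F) (x : Fˣ) :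
    (w.maximalIdeal.valuation F) (x : F) ≠ 0 :=
  (Valuation.ne_zero_iff _).mpr x.ne_zero

variable (F) in
/-- `ord_v(x) ∈ ℤ ≅ ord(F_v) = F_v^×/O_v^×` for `x ∈ F^×` and a nonarchimedean `v` (FrdI Ex. 6.3
p. 112): the exponent of the maximal ideal of `v` in `x` (Mathlib's `ℤᵐ⁰`-valued valuation of `v`
is `ofAdd (-ord_v x)`). [cite: MochizukiFrdI2008, Ex. 6.3 p.112] -/
def ordFin (w : FinitePlace F) (x : Fˣ) : ℤ :=
  -Multiplicative.toAdd (WithZero.unzero (valuation_coe_units_ne_zero w x))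

/-- `ord_v` is a homomorphism: `ord_v(xy) = ord_v(x) + ord_v(y)`. [cite: MochizukiFrdI2008, Ex. 6.3 p.112] -/
theorem ordFin_mul (w : FinitePlace F) (x y : Fˣ) :
    ordFin F w (x * y) = ordFin F w x + ordFin F w y := by
  have h : WithZero.unzero (valuation_coe_units_ne_zero w (x * y)) =
      WithZero.unzero (valuation_coe_units_ne_zero w x) *
        WithZero.unzero (valuation_coe_units_ne_zero w y) := by
    rw [← WithZero.coe_inj, WithZero.coe_mul, WithZero.coe_unzero, WithZero.coe_unzero,
      WithZero.coe_unzero, Units.val_mul, map_mul]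
  unfold ordFin
  rw [h, toAdd_mul, neg_add]

/-- The normalised absolute value of a finite place is `|x|_v = N(v)^{-ord_v(x)}`.
[cite: MochizukiFrdI2008, Ex. 6.3 p.113] -/
theorem apply_eq_absNorm_zpow (w : FinitePlace F) (x : Fˣ) :
    w (x : F) = ((Ideal.absNorm w.maximalIdeal.asIdeal : ℝ)) ^ (-ordFin F w x) := by
  rw [← FinitePlace.norm_embedding_eq, FinitePlace.norm_embedding',
    WithZeroMulInt.toNNReal_neg_apply _ (valuation_coe_units_ne_zero w x), NNReal.coe_zpow]
  simp [ordFin]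

/-- `log |x|_v = -ord_v(x) · log N(v)` at a finite place. [cite: MochizukiFrdI2008, Ex. 6.3 p.113] -/
theorem log_apply_eq (w : FinitePlace F) (x : Fˣ) :
    Real.log (w (x : F)) = -(ordFin F w x : ℝ) * Real.log (Ideal.absNorm w.maximalIdeal.asIdeal : ℝ) := by
  rw [apply_eq_absNorm_zpow, Real.log_zpow]
  push_cast
  ring

/-- `|x|_v = 1` iff `ord_v(x) = 0`. [cite: MochizukiFrdI2008, Ex. 6.3 p.113] -/
theorem apply_eq_one_iff_ordFin_eq_zero (w : FinitePlace F) (x : Fˣ) :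
    w (x : F) = 1 ↔ ordFin F w x = 0 := by
  have h1 : (1 : ℝ) < (Ideal.absNorm w.maximalIdeal.asIdeal : ℝ) := by
    exact_mod_cast NumberField.HeightOneSpectrum.one_lt_absNorm w.maximalIdeal
  rw [apply_eq_absNorm_zpow]
  constructor
  · intro h
    have := zpow_right_injective₀ (by linarith) h1.ne' (h.trans (zpow_zero _).symm)
    omega
  · intro h
    rw [h, neg_zero, zpow_zero]

/-- "All but a finite number of [the `ord_v(f)`] are zero" (FrdI Ex. 6.3 p. 113).
[cite: MochizukiFrdI2008, Ex. 6.3 p.113] -/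
theorem ordFin_finite_support (x : Fˣ) : (Function.support fun w : FinitePlace F => ordFin F w x).Finite := by
  refine (FinitePlace.hasFiniteMulSupport (K := F) x.ne_zero).subset fun w hw => ?_
  simp only [Function.mem_support, ne_eq] at hw
  simp only [Function.mem_mulSupport, ne_eq, apply_eq_one_iff_ordFin_eq_zero]
  exact hw

variable (F) in
/-- The arithmetic divisor `div(f) ∈ Φ(F)^gp` of `f ∈ F^×`: `(ord_v(f))_v` at the finite places,
`(-log|f|_v)_v` at the infinite places (the image of `f` in the factors `F_v^×/O_v^× = ord(F_v)`,
FrdI Ex. 6.3 p. 113). [cite: MochizukiFrdI2008, Ex. 6.3 p.113] -/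
def principalArithDivisor (x : Fˣ) : ArithDivisor F :=
  (Finsupp.ofSupportFinite (fun w => ordFin F w x) (ordFin_finite_support x),
    fun w => -Real.log (w (x : F)))

/-- Finite components of `div(f)`. [cite: MochizukiFrdI2008, Ex. 6.3 p.113] -/
@[simp] theorem principalArithDivisor_fst (x : Fˣ) (w : FinitePlace F) :
    (principalArithDivisor F x).1 w = ordFin F w x := rfl

/-- Infinite components of `div(f)`. [cite: MochizukiFrdI2008, Ex. 6.3 p.113] -/
@[simp] theorem principalArithDivisor_snd (x : Fˣ) (w : InfinitePlace F) :
    (principalArithDivisor F x).2 w = -Real.log (w (x : F)) := rfl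

/-- `div(fg) = div(f) + div(g)`. [cite: MochizukiFrdI2008, Ex. 6.3 p.113] -/
theorem principalArithDivisor_mul (x y : Fˣ) :
    principalArithDivisor F (x * y) = principalArithDivisor F x + principalArithDivisor F y := by
  refine Prod.ext (Finsupp.ext fun w => ?_) (funext fun w => ?_)
  · simp [ordFin_mul]
  · simp only [principalArithDivisor_snd, Prod.snd_add, Pi.add_apply, Units.val_mul, map_mul]
    rw [Real.log_mul (InfinitePlace.pos_iff.mpr x.ne_zero).ne' (InfinitePlace.pos_iff.mpr y.ne_zero).ne']
    ring

variable (F) in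
/-- The "natural homomorphism of groups `B(F) := F^× → Φ(F)^gp`" (FrdI Ex. 6.3 p. 113), as a
monoid homomorphism into the (multiplicatively written) group of arithmetic divisors.
[cite: MochizukiFrdI2008, Ex. 6.3 p.113] -/
def principalArithDivisorHom : Fˣ →* Multiplicative (ArithDivisor F) where
  toFun x := Multiplicative.ofAdd (principalArithDivisor F x)
  map_one' := by
    have h : principalArithDivisor F 1 + principalArithDivisor F 1 = principalArithDivisor F 1 := by
      rw [← principalArithDivisor_mul, mul_one]
    have h' : principalArithDivisor F 1 = 0 := by simpa using h
    rw [h', ofAdd_zero]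
  map_mul' x y := by rw [principalArithDivisor_mul, ofAdd_add]

end Ord

/-! ### The arithmetic degree (pp. 113–114) -/

/-- The *arithmetic degree* `deg^arith_F : Φ(F)^gp → ℝ` (FrdI Ex. 6.3 pp. 113–114): on the factor
`ord(F_v) ≅ ℤ` of a nonarchimedean `v`, `n ↦ n · log N(v)` ("the natural logarithm of the cardinality
of `O_v/(λ)`" for `λ ∈ O_v^▷` of order `n`); on the factor `ord(F_v) ≅ ℝ` of an archimedean `v`,
`t ↦ [F_v : ℝ] · t` (the class of `λ ∈ ℝ_{>0}`, of coordinate `t = -log λ`, goes to `-[F_v : ℝ] · log λ`).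
[cite: MochizukiFrdI2008, Ex. 6.3 p.113] -/
def arithDegree : ArithDivisor F →+ ℝ :=
  (Finsupp.liftAddHom fun w : FinitePlace F =>
      zmultiplesHom ℝ (Real.log (Ideal.absNorm w.maximalIdeal.asIdeal : ℝ))).comp
      (AddMonoidHom.fst _ _) +
    ({ toFun := fun t => ∑ w : InfinitePlace F, (w.mult : ℝ) * t w
       map_zero' := by simp
       map_add' := fun s t => by
         simp only [Pi.add_apply, mul_add, Finset.sum_add_distrib] } : (InfinitePlace F → ℝ) →+ ℝ).comp
      (AddMonoidHom.snd _ _)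

/-- Unfolding the arithmetic degree: `deg^arith(d) = Σ_{v fin} d_v log N(v) + Σ_{v inf} [F_v:ℝ] d_v`.
[cite: MochizukiFrdI2008, Ex. 6.3 p.113] -/
theorem arithDegree_apply (d : ArithDivisor F) :
    arithDegree F d =
      (d.1.sum fun w n => (n : ℝ) * Real.log (Ideal.absNorm w.maximalIdeal.asIdeal : ℝ)) +
        ∑ w : InfinitePlace F, (w.mult : ℝ) * d.2 w := by
  simp only [arithDegree, AddMonoidHom.add_apply, AddMonoidHom.coe_comp, Function.comp_apply,
    AddMonoidHom.coe_fst, AddMonoidHom.coe_snd, Finsupp.liftAddHom_apply, AddMonoidHom.coe_mk,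
    ZeroHom.coe_mk]
  unfold Finsupp.sum
  simp only [zmultiplesHom_apply, zsmul_eq_mul]

/-- The degree of the effective divisor of `λ ∈ O_v^▷` of order `n` at a nonarchimedean `v` is
`n · log N(v) = log #(O_v/(λ))` (FrdI Ex. 6.3 p. 114). [cite: MochizukiFrdI2008, Ex. 6.3 p.114] -/
theorem arithDegree_single (w : FinitePlace F) (n : ℤ) :
    arithDegree F (Finsupp.single w n, 0) = n * Real.log (Ideal.absNorm w.maximalIdeal.asIdeal : ℝ) := by
  rw [arithDegree_apply, Finsupp.sum_single_index (by simp)]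
  simp

/-- The degree of the divisor at an archimedean `v` of coordinate `t` is `[F_v : ℝ] · t`
(FrdI Ex. 6.3 p. 113: `λ ∈ ℝ_{>0} ↦ -[F_v : ℝ] · log λ`). [cite: MochizukiFrdI2008, Ex. 6.3 p.113] -/
theorem arithDegree_inf (t : InfinitePlace F → ℝ) :
    arithDegree F (0, t) = ∑ w : InfinitePlace F, (w.mult : ℝ) * t w := by
  rw [arithDegree_apply]
  simp

/-- **"One verifies immediately that `deg^arith_L` vanishes on the image of `B(L)`"** (FrdI Ex. 6.3
p. 114) — the product formula: `deg^arith(div f) = -log (∏_{v inf} |f|_v^{[F_v:ℝ]} · ∏_{v fin} |f|_v)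
= -log 1 = 0`. [cite: MochizukiFrdI2008, Ex. 6.3 p.114] -/
theorem arithDegree_principalArithDivisor (x : Fˣ) :
    arithDegree F (principalArithDivisor F x) = 0 := by
  have hx : (x : F) ≠ 0 := x.ne_zero
  rw [arithDegree_apply]
  -- the finite part: `Σ_{v ∈ supp} ord_v(f) log N(v) = -log ∏ᶠ_v |f|_v`
  have hfin : ((principalArithDivisor F x).1.sum fun w n =>
        (n : ℝ) * Real.log (Ideal.absNorm w.maximalIdeal.asIdeal : ℝ)) =
      -Real.log (∏ᶠ w : FinitePlace F, w (x : F)) := by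
    have hsupp : (Function.mulSupport fun w : FinitePlace F => w (x : F)) ⊆
        ((principalArithDivisor F x).1.support : Set (FinitePlace F)) := by
      intro w hw
      simp only [Function.mem_mulSupport, ne_eq, apply_eq_one_iff_ordFin_eq_zero] at hw
      simp only [Finset.mem_coe, Finsupp.mem_support_iff, principalArithDivisor_fst, ne_eq]
      exact hw
    rw [finprod_eq_prod_of_mulSupport_subset _ hsupp,
      Real.log_prod (fun w _ => (FinitePlace.pos_iff.mpr hx).ne'), ← Finset.sum_neg_distrib]
    refine Finset.sum_congr rfl fun w _ => ?_
    rw [principalArithDivisor_fst, log_apply_eq]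
    ring
  -- the infinite part: `Σ_v [F_v:ℝ] (-log|f|_v) = -log ∏_v |f|_v^{[F_v:ℝ]}`
  have hinf : (∑ w : InfinitePlace F, (w.mult : ℝ) * (principalArithDivisor F x).2 w) =
      -Real.log (∏ w : InfinitePlace F, w (x : F) ^ w.mult) := by
    rw [Real.log_prod (fun w _ => pow_ne_zero _ (InfinitePlace.pos_iff.mpr hx).ne'),
      ← Finset.sum_neg_distrib]
    refine Finset.sum_congr rfl fun w _ => ?_
    rw [principalArithDivisor_snd, Real.log_pow]
    ring
  rw [hfin, hinf, ← neg_add, ← Real.log_mul, mul_comm, prod_abs_eq_one hx, Real.log_one, neg_zero]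
  · rw [finprod_eq_prod_of_mulSupport_subset _ (Function.mulSupport_subset_iff'.mpr fun w hw => by
        simpa using hw : (Function.mulSupport fun w : FinitePlace F => w (x : F)) ⊆
          ((FinitePlace.hasFiniteMulSupport (K := F) hx).toFinset : Set (FinitePlace F)))]
    exact Finset.prod_ne_zero_iff.mpr fun w _ => (FinitePlace.pos_iff.mpr hx).ne'
  · exact Finset.prod_ne_zero_iff.mpr fun w _ => pow_ne_zero _ (InfinitePlace.pos_iff.mpr hx).ne'

/-- Hence `deg^arith ∘ div` is the trivial homomorphism `B(F) → ℝ` (FrdI Ex. 6.3 p. 114).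
[cite: MochizukiFrdI2008, Ex. 6.3 p.114] -/
theorem arithDegree_comp_principalArithDivisorHom (x : Fˣ) :
    arithDegree F (Multiplicative.toAdd (principalArithDivisorHom F x)) = 0 :=
  arithDegree_principalArithDivisor F x

end Literature.AlgebraicGeometry.Frobenioids

end
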